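import Summits.BirchSwinnertonDyer.Rank1Residual.ManinAdditive.TwoTorsionVisibility
import Summits.BirchSwinnertonDyer.BirchSwinnertonDyer.Theorems.ManinLocalTwoThreeConwayNortonSameLevelTwist
import HarnessLib

/-!
# (P-desc-2) `MemConwayNortonOfSameLevelTwist` HOLDS: `memConwayNortonOfSameLevelTwist_holds`
# (cell `bsd-f2-manin`; the `…Holds` sibling of the conjecture leaf `TwoTorsionVisibility`, typer g13, T-desc-14)

desc's support row P-desc-2 (MEMO-desc §25.2/§27.1; answer to prover-2's GAP NOTE on E-desc-52) is the tree THEOREM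
`Summit.BirchSwinnertonDyer.BirchSwinnertonDyer.Theorems.ManinLocalTwoThree.memConwayNortonLatticeAtThree_of_sameLevelTwist`
(`Theorems/ManinLocalTwoThreeConwayNortonSameLevelTwist.lean`, prover p2 g9, p644922): for a newform `f ∈ S₂(Γ₀(N))`, `9 ∣ N`,
with integer coefficients whose `χ₋₃`-twist is again a level-`N` newform, both `f` and `f ⊗ χ₋₃` lie in the Conway–Norton
lattice `M^G(N)` at `3`.  REF1 §R72 A79.4 (refuter-ref1 g10): «binders identical; one-line proof by name» — this file is that
line (conjecture-leaf convention: the leaf has no `Theorems/` import; the discharge lives in the sibling).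
PROVED; axioms standard.  bears_on: stmt-BirchSwinnertonDyer-22968.  BSD is not proved by this; Manin's conjecture is not
proved by this; C3 is not closed by this.
-/

noncomputable section

namespace Summit.BirchSwinnertonDyer.Rank1Residual.ManinAdditive.TwoTorsionVisibility

/-- **P-desc-2 holds** (REF1 §R72 A79.4): `MemConwayNortonOfSameLevelTwist` is prover p2's theorem
`memConwayNortonLatticeAtThree_of_sameLevelTwist` (p644922). -/
theorem memConwayNortonOfSameLevelTwist_holds : MemConwayNortonOfSameLevelTwist :=
  fun _N _ h9 _χ hχ hprim _f hf hg hint =>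
    Summit.BirchSwinnertonDyer.BirchSwinnertonDyer.Theorems.ManinLocalTwoThree.memConwayNortonLatticeAtThree_of_sameLevelTwist
      h9 hχ hprim hf hg hint

end Summit.BirchSwinnertonDyer.Rank1Residual.ManinAdditive.TwoTorsionVisibility

end
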